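import Mathlib
import HarnessLib
import Summits.NavierStokesRegularity.NavierStokesRegularity.Theorems.LocalSineTubeDoorLocalPointZoomHessSlices
import Summits.NavierStokesRegularity.NavierStokesRegularity.Theorems.LocalSineTubeDoorWindowFatouSecondOrder

/-!
# The one-window door family as ONE theorem — SECOND-ORDER scalars: generic door `F(u, ∇u, ∇²u)` ⇐ its profile crux

Cell ns-regularity-ideate, seat p6 (route-directed support for nsreg-p1's door family; anchor
`--supports stmt-NavierStokesRegularity-20017`).  Composition of the second-order universal zoom
`…LocalPointZoomHessSlices.localPointZoomVelGradHessSlices` with the second-order window glue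
`…WindowFatouSecondOrder.windowFatou_secondOrder_of_zeroSetInvariant` — the twin of `…GenericDoor` for window scalars
that involve second derivatives of the velocity (e.g. the super-helicity `ω · curl ω`, alignment of `∇ω`, `Δu`-based
quantities):

* `genericDoor2_of_profileWindowRigidity` — for ANY continuous `F(x, A, B)` (velocity value, gradient, Hessian) whose zero
  set is invariant under positive rescalings of the three arguments: profile WINDOW crux (`F(v, Dv, D²v)` vanishes on a
  nonempty open window at every `s < 0` ⇒ not backward-singular) ⇒ DOOR (classical Leray–Hopf + rapid decay + local
  Type I at `(x₀,T)` + `∫_U |F(√(T−t) u, (T−t) ∇u, √(T−t)³ ∇²u)(t, x₀ + √(T−t)y)| dy → 0` on ONE nonempty open window ⇒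
  backward bounded at `x₀`);
* `genericDoor2_of_profileRigidity` — the same with the crux split into window→slab + slab Liouville.

WHAT THIS IS NOT: not a claim about Navier–Stokes regularity; the second-order door TEMPLATE proved once, conditional on
the profile crux that appears as an explicit hypothesis (bears_on LADDER-NS N0).
-/

noncomputable section

-- the summit and its single sub-problem share the name (CONVENTIONS §1), as in every Theorems file
set_option linter.dupNamespace false

namespace Summit.NavierStokesRegularity.NavierStokesRegularity.Theorems.LocalSineTubeDoorGenericDoorSecondOrder

open MeasureTheory Set Function Filter Topology TopologicalSpace Metric
open scoped RealInnerProductSpace InnerProductSpace NNReal ENNReal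
open Literature.Analysis Literature.Analysis.FluidPDE
open Summit.NavierStokesRegularity.NavierStokesRegularity.Theorems.LocalSineTubeDoorLocalPointZoomHessSlices
open Summit.NavierStokesRegularity.NavierStokesRegularity.Theorems.LocalSineTubeDoorWindowFatouSecondOrder

/-- **GENERIC SECOND-ORDER ONE-WINDOW DOOR ⇐ ITS PROFILE WINDOW CRUX.**  See the module docstring. -/
theorem genericDoor2_of_profileWindowRigidity
    (F : EuclideanSpace ℝ (Fin 3) → (EuclideanSpace ℝ (Fin 3) →L[ℝ] EuclideanSpace ℝ (Fin 3)) →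
      ContinuousMultilinearMap ℝ (fun _ : Fin 2 => EuclideanSpace ℝ (Fin 3)) (EuclideanSpace ℝ (Fin 3)) → ℝ)
    (hF : Continuous fun q : EuclideanSpace ℝ (Fin 3) × (EuclideanSpace ℝ (Fin 3) →L[ℝ] EuclideanSpace ℝ (Fin 3)) ×
      ContinuousMultilinearMap ℝ (fun _ : Fin 2 => EuclideanSpace ℝ (Fin 3)) (EuclideanSpace ℝ (Fin 3)) =>
      F q.1 q.2.1 q.2.2)
    (hzero : ∀ (a b c : ℝ), 0 < a → 0 < b → 0 < c → ∀ (x : EuclideanSpace ℝ (Fin 3))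
      (A : EuclideanSpace ℝ (Fin 3) →L[ℝ] EuclideanSpace ℝ (Fin 3))
      (B : ContinuousMultilinearMap ℝ (fun _ : Fin 2 => EuclideanSpace ℝ (Fin 3)) (EuclideanSpace ℝ (Fin 3))),
      F (a • x) (b • A) (c • B) = 0 ↔ F x A B = 0)
    (hcrux : ∀ (C : ℝ) (v : ℝ → EuclideanSpace ℝ (Fin 3) → EuclideanSpace ℝ (Fin 3)),
      Literature.Analysis.FluidPDE.HasTypeITimeDecay C v →
      ContinuousOn (Function.uncurry v) (Set.Iio (0 : ℝ) ×ˢ Set.univ) →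
      (∀ s t : ℝ, s < t → t < 0 → ∀ x, v t x =
        Literature.Analysis.UnboundedOperators.heatExtension (v s) (t - s) x -
          Literature.Analysis.FluidPDE.oseenDuhamel 1 s v v t x) →
      (∀ t < 0, Literature.Analysis.FluidPDE.VectorCalculus.IsDivFree (v t)) →
      (∀ s < 0, ∃ U : Set (EuclideanSpace ℝ (Fin 3)), IsOpen U ∧ U.Nonempty ∧
        ∀ z ∈ U, F (v s z) (fderiv ℝ (v s) z) (iteratedFDeriv ℝ 2 (v s) z) = 0) →
      ¬ Literature.Analysis.FluidPDE.IsBackwardSingularPoint v 0) :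
    ∀ (ν T : ℝ), 0 < ν → 0 < T → ∀ (u : ℝ → EuclideanSpace ℝ (Fin 3) → EuclideanSpace ℝ (Fin 3))
      (p : ℝ → EuclideanSpace ℝ (Fin 3) → ℝ),
    Literature.Analysis.FluidPDE.IsClassicalNSSolutionOn (Set.Ico 0 T) ν 0 u p →
    Literature.Analysis.FluidPDE.IsLerayHopfOn T ν 0 (u 0) u →
    Literature.Analysis.FluidPDE.HasRapidSpatialDecay (u 0) →
    ∀ (x₀ : EuclideanSpace ℝ (Fin 3)) (ρ M : ℝ), 0 < ρ →
    (∀ t ∈ Set.Ico 0 T, T - ρ ^ 2 < t → ∀ x ∈ Metric.ball x₀ ρ, ‖u t x‖ * Real.sqrt (ν * (T - t)) ≤ M) →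
    ∀ (U : Set (EuclideanSpace ℝ (Fin 3))), IsOpen U → U.Nonempty →
    Filter.Tendsto (fun t => ∫⁻ y in U, ENNReal.ofReal
      |F (Real.sqrt (T - t) • u t (x₀ + Real.sqrt (T - t) • y))
        (Real.sqrt (T - t) ^ 2 • fderiv ℝ (u t) (x₀ + Real.sqrt (T - t) • y))
        (Real.sqrt (T - t) ^ 3 • iteratedFDeriv ℝ 2 (u t) (x₀ + Real.sqrt (T - t) • y))|)
      (nhdsWithin T (Set.Iio T)) (nhds 0) →
    Literature.Analysis.FluidPDE.IsBackwardBoundedAt u T x₀ := by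
  intro ν T hν hT u p hcl hLH hdec x₀ ρ M hρ hM U hU hUne hfade
  by_contra hnot
  obtain ⟨C, v, lam, hlam, hlam0, ⟨hrate, hcont, hmild, hdiv⟩, hsing, hconv⟩ :=
    localPointZoomVelGradHessSlices ν T hν hT u p hcl hLH hdec x₀ ρ M hρ hM hnot
  refine hcrux C v hrate hcont hmild hdiv (fun s hs => ?_) hsing
  have hns : 0 < -s := neg_pos.2 hs
  set σ : ℝ := Real.sqrt (-s) / Real.sqrt ν with hσ
  have hσpos : 0 < σ := div_pos (Real.sqrt_pos.2 hns) (Real.sqrt_pos.2 hν)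
  refine ⟨(fun z => σ⁻¹ • z) ⁻¹' U, hU.preimage (continuous_const_smul σ⁻¹), ?_, fun z hz => ?_⟩
  · obtain ⟨u₀, hu₀⟩ := hUne
    refine ⟨σ • u₀, ?_⟩
    show σ⁻¹ • (σ • u₀) ∈ U
    rwa [smul_smul, inv_mul_cancel₀ hσpos.ne', one_smul]
  · exact windowFatou_secondOrder_of_zeroSetInvariant hν hT hcl hlam hlam0 hrate hcont hmild hconv F hF hzero hU
      hfade hs hz

/-- **GENERIC SECOND-ORDER ONE-WINDOW DOOR ⇐ ITS PROFILE SLAB CRUX + WINDOW-TO-SLAB.**  The same door, with the profile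
crux split as in the family's K2-type cruxes: a window-to-slab statement for the scalar `F` on the class (for the doors
so far: slice real-analyticity + identity theorem) and the profile-Liouville statement «`F(v, Dv) ≡ 0` on every slice
`s < 0` ⇒ not backward-singular». -/
theorem genericDoor2_of_profileRigidity
    (F : EuclideanSpace ℝ (Fin 3) → (EuclideanSpace ℝ (Fin 3) →L[ℝ] EuclideanSpace ℝ (Fin 3)) →
      ContinuousMultilinearMap ℝ (fun _ : Fin 2 => EuclideanSpace ℝ (Fin 3)) (EuclideanSpace ℝ (Fin 3)) → ℝ)
    (hF : Continuous fun q : EuclideanSpace ℝ (Fin 3) × (EuclideanSpace ℝ (Fin 3) →L[ℝ] EuclideanSpace ℝ (Fin 3)) ×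
      ContinuousMultilinearMap ℝ (fun _ : Fin 2 => EuclideanSpace ℝ (Fin 3)) (EuclideanSpace ℝ (Fin 3)) =>
      F q.1 q.2.1 q.2.2)
    (hzero : ∀ (a b c : ℝ), 0 < a → 0 < b → 0 < c → ∀ (x : EuclideanSpace ℝ (Fin 3))
      (A : EuclideanSpace ℝ (Fin 3) →L[ℝ] EuclideanSpace ℝ (Fin 3))
      (B : ContinuousMultilinearMap ℝ (fun _ : Fin 2 => EuclideanSpace ℝ (Fin 3)) (EuclideanSpace ℝ (Fin 3))),
      F (a • x) (b • A) (c • B) = 0 ↔ F x A B = 0)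
    (hwin : ∀ (C : ℝ) (v : ℝ → EuclideanSpace ℝ (Fin 3) → EuclideanSpace ℝ (Fin 3)),
      Literature.Analysis.FluidPDE.HasTypeITimeDecay C v →
      ContinuousOn (Function.uncurry v) (Set.Iio (0 : ℝ) ×ˢ Set.univ) →
      (∀ s t : ℝ, s < t → t < 0 → ∀ x, v t x =
        Literature.Analysis.UnboundedOperators.heatExtension (v s) (t - s) x -
          Literature.Analysis.FluidPDE.oseenDuhamel 1 s v v t x) →
      (∀ t < 0, Literature.Analysis.FluidPDE.VectorCalculus.IsDivFree (v t)) →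
      (∀ s < 0, ∃ U : Set (EuclideanSpace ℝ (Fin 3)), IsOpen U ∧ U.Nonempty ∧
        ∀ z ∈ U, F (v s z) (fderiv ℝ (v s) z) (iteratedFDeriv ℝ 2 (v s) z) = 0) →
      ∀ s < 0, ∀ z, F (v s z) (fderiv ℝ (v s) z) (iteratedFDeriv ℝ 2 (v s) z) = 0)
    (hslab : ∀ (C : ℝ) (v : ℝ → EuclideanSpace ℝ (Fin 3) → EuclideanSpace ℝ (Fin 3)),
      Literature.Analysis.FluidPDE.HasTypeITimeDecay C v →
      ContinuousOn (Function.uncurry v) (Set.Iio (0 : ℝ) ×ˢ Set.univ) →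
      (∀ s t : ℝ, s < t → t < 0 → ∀ x, v t x =
        Literature.Analysis.UnboundedOperators.heatExtension (v s) (t - s) x -
          Literature.Analysis.FluidPDE.oseenDuhamel 1 s v v t x) →
      (∀ t < 0, Literature.Analysis.FluidPDE.VectorCalculus.IsDivFree (v t)) →
      (∀ s < 0, ∀ z, F (v s z) (fderiv ℝ (v s) z) (iteratedFDeriv ℝ 2 (v s) z) = 0) →
      ¬ Literature.Analysis.FluidPDE.IsBackwardSingularPoint v 0) :
    ∀ (ν T : ℝ), 0 < ν → 0 < T → ∀ (u : ℝ → EuclideanSpace ℝ (Fin 3) → EuclideanSpace ℝ (Fin 3))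
      (p : ℝ → EuclideanSpace ℝ (Fin 3) → ℝ),
    Literature.Analysis.FluidPDE.IsClassicalNSSolutionOn (Set.Ico 0 T) ν 0 u p →
    Literature.Analysis.FluidPDE.IsLerayHopfOn T ν 0 (u 0) u →
    Literature.Analysis.FluidPDE.HasRapidSpatialDecay (u 0) →
    ∀ (x₀ : EuclideanSpace ℝ (Fin 3)) (ρ M : ℝ), 0 < ρ →
    (∀ t ∈ Set.Ico 0 T, T - ρ ^ 2 < t → ∀ x ∈ Metric.ball x₀ ρ, ‖u t x‖ * Real.sqrt (ν * (T - t)) ≤ M) →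
    ∀ (U : Set (EuclideanSpace ℝ (Fin 3))), IsOpen U → U.Nonempty →
    Filter.Tendsto (fun t => ∫⁻ y in U, ENNReal.ofReal
      |F (Real.sqrt (T - t) • u t (x₀ + Real.sqrt (T - t) • y))
        (Real.sqrt (T - t) ^ 2 • fderiv ℝ (u t) (x₀ + Real.sqrt (T - t) • y))
        (Real.sqrt (T - t) ^ 3 • iteratedFDeriv ℝ 2 (u t) (x₀ + Real.sqrt (T - t) • y))|)
      (nhdsWithin T (Set.Iio T)) (nhds 0) →
    Literature.Analysis.FluidPDE.IsBackwardBoundedAt u T x₀ :=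
  genericDoor2_of_profileWindowRigidity F hF hzero fun C v hrate hcont hmild hdiv hU =>
    hslab C v hrate hcont hmild hdiv (hwin C v hrate hcont hmild hdiv hU)

end Summit.NavierStokesRegularity.NavierStokesRegularity.Theorems.LocalSineTubeDoorGenericDoorSecondOrder

end
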